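import Mathlib
import Summits.PneNP.PneNP.Theorems.ConvexRankGatesConvexGateBlindRainbowLevelSums

/-!
# PneNP / ConvexRankGates — `ConvexGateBlind`: the level-`t` rainbow functional (small colour classes), II: inclusion numbers

Helpers (`--supports stmt-PneNP-10680`), concluding `…RainbowLevelSums.lean`. THEOREM (`rbLt_indicator`, registered stub
`rainbow_marginal_level`): for a colouring `h : Fin m → Fin K` with classes of common size `n ≥ t + 2`, `t + 1 ≤ K`, and
`#T ≤ t`,
  `L_t(𝟙[T ⊆ ·]) = [T rainbow] · K · n^{K - #T} / (K + 1 - #T)`,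
the same inclusion numbers as the rainbow pseudo-distribution `rbL` (which needs `n ≥ K + 1`). Unlike for `rbL` the
per-class values are not uniform: a class carrying a vertex of `T` contributes
`n^{K-#T} (t+2) C(K,#T-1) / ((K+1)(t+1) C(K-1,#T-1))` (`rbLt_class_value_of_mem`), a free class
`n^{K-#T} (t+2) [C(K,#T)/(t+1) - C(K+1,#T)/((t+1)(t+2))] / ((K+1) C(K-1,#T))` (`rbLt_class_value_of_not_mem`), every class
contributes `0` when `T` is not rainbow (`rbLt_class_value_of_not_injOn`); the exchange identity
`C(N,a)C(N-a,b) = C(N,b)C(N-b,a)` turns each clump-size sum into one of the three alternating sums of `…RainbowLevelSums.lean`.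
Consequence (next files): junta / symmetric certificates are ε-exactly blind on colouring columns whose classes have size
only `t + 2` — the locality threshold is the CLASS SIZE — and poly-size symmetric LP row objects must break the symmetry of
vertex blocks of size `O(⌈m^δ⌉)`. [new]
-/

namespace Summit.PneNP.PneNP.Theorems

open Finset

set_option linter.dupNamespace false

noncomputable section

variable {m K : ℕ}

/-! ## Per-class values of `L_t(𝟙[T ⊆ ·])` -/

/-- The per-class value for a rainbow `T` at a class CARRYING a vertex of `T`:
`n^{K-#T} (t+2) C(K, #T-1) / ((K+1) C(K-1, #T-1) (t+1))`. -/
theorem rbLt_class_value_of_mem (h : Fin m → Fin K) {n t : ℕ} (htn : t + 2 ≤ n) (htK : t + 1 ≤ K)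
    {T : Finset (Fin m)} (hinj : Set.InjOn h ↑T) (hT : T.card ≤ t) {i : Fin K} (hi : i ∈ T.image h) :
    (if Set.InjOn h ↑(T.filter fun v => h v ≠ i) then (n : ℝ) ^ (K - (T.filter fun v => h v ≠ i).card) else 0) /
          (n.choose (T.filter fun v => h v = i).card : ℝ) *
        ∑ j ∈ range (t + 1), (-1 : ℝ) ^ j * ((t : ℝ) + 2) * (t.choose j : ℝ) *
          ((K - 1 - ((T.filter fun v => h v ≠ i).image h).card).choose j : ℝ) *
          ((j + 2).choose (T.filter fun v => h v = i).card : ℝ) /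
            (((K : ℝ) + 1) * ((K - 1).choose j : ℝ) * (((j : ℝ) + 1) * ((j : ℝ) + 2))) =
      (n : ℝ) ^ (K - T.card) * (((t : ℝ) + 2) * (K.choose (T.card - 1) : ℝ) /
        (((K : ℝ) + 1) * ((K - 1).choose (T.card - 1) : ℝ) * ((t : ℝ) + 1))) := by
  classical
  set T' := T.filter fun v => h v ≠ i with hT'
  set Ti := T.filter fun v => h v = i with hTi
  set H := T'.image h with hHdef
  have hinj' : Set.InjOn h ↑T' := hinj.mono (by rw [hT']; exact coe_subset.2 (filter_subset _ _))
  have hH : H.card = T'.card := card_image_of_injOn hinj'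
  have hsplit : Ti.card + T'.card = T.card := by
    have := Finset.card_filter_add_card_filter_not (s := T) (fun v => h v = i)
    rw [← hTi] at this
    convert this using 2
  have hn0 : (n : ℝ) ≠ 0 := by
    have : 0 < n := by omega
    positivity
  -- exactly one vertex of `T` has colour `i`
  have hκ : Ti.card = 1 := by
    refine le_antisymm ?_ ?_
    · exact Finset.card_le_one.2 fun a ha b hb =>
        hinj (mem_coe.2 (mem_filter.1 ha).1) (mem_coe.2 (mem_filter.1 hb).1)
          ((mem_filter.1 ha).2.trans (mem_filter.1 hb).2.symm)
    · obtain ⟨v, hv, hvi⟩ := mem_image.1 hi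
      exact Finset.card_pos.2 ⟨v, mem_filter.2 ⟨hv, hvi⟩⟩
  have hT1 : 1 ≤ T.card := by omega
  have hT'card : T'.card = T.card - 1 := by omega
  rw [if_pos hinj', hH, hκ, hT'card]
  simp only [Nat.choose_one_right]
  -- the `j`-sum: exchange `C(K-1-(s-1), j) / C(K-1, j) = C(K-1-j, s-1) / C(K-1, s-1)` and evaluate
  set s := T.card with hs
  have hsK : s - 1 ≤ K - 1 := by omega
  have hCKs : ((K - 1).choose (s - 1) : ℝ) ≠ 0 := by
    have := Nat.choose_pos hsK
    positivity
  have hterm : ∀ j ∈ range (t + 1),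
      (-1 : ℝ) ^ j * ((t : ℝ) + 2) * (t.choose j : ℝ) * ((K - 1 - (s - 1)).choose j : ℝ) * ((j + 2 : ℕ) : ℝ) /
          (((K : ℝ) + 1) * ((K - 1).choose j : ℝ) * (((j : ℝ) + 1) * ((j : ℝ) + 2))) =
        (((t : ℝ) + 2) / (((K : ℝ) + 1) * ((K - 1).choose (s - 1) : ℝ))) *
          ((-1 : ℝ) ^ j * (t.choose j : ℝ) * ((K - 1 - j).choose (s - 1) : ℝ) / ((j : ℝ) + 1)) := by
    intro j hj
    have hjt : j < t + 1 := mem_range.1 hj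
    have hCKj : ((K - 1).choose j : ℝ) ≠ 0 := by
      have := Nat.choose_pos (show j ≤ K - 1 by omega)
      positivity
    have hj1 : (j : ℝ) + 1 ≠ 0 := by positivity
    have hj2 : (j : ℝ) + 2 ≠ 0 := by positivity
    have hK1 : (K : ℝ) + 1 ≠ 0 := by positivity
    have hex := choose_mul_choose_sub_comm (K - 1) (s - 1) j
    -- hex : C(K-1, s-1) C(K-1-(s-1), j) = C(K-1, j) C(K-1-j, s-1)
    have hex' : ((K - 1 - (s - 1)).choose j : ℝ) =
        ((K - 1).choose j : ℝ) * ((K - 1 - j).choose (s - 1) : ℝ) / ((K - 1).choose (s - 1) : ℝ) := by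
      rw [eq_div_iff hCKs]; linarith
    rw [hex']
    push_cast
    field_simp
  rw [Finset.sum_congr rfl hterm, ← Finset.mul_sum,
    alt_sum_choose_choose_sub_div_succ t (s - 1) (K - 1) (by omega) (by omega),
    show K - 1 + 1 = K by omega]
  have hpow : (n : ℝ) ^ (K - (s - 1)) = (n : ℝ) ^ (K - s) * n := by
    rw [show K - (s - 1) = (K - s) + 1 by omega, pow_succ]
  rw [hpow]
  have ht1 : (t : ℝ) + 1 ≠ 0 := by positivity
  have hK1 : (K : ℝ) + 1 ≠ 0 := by positivity
  field_simp

/-- The per-class value for a rainbow `T` at a class carrying NO vertex of `T`: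
`n^{K-#T} (t+2) [C(K,#T)/(t+1) - C(K+1,#T)/((t+1)(t+2))] / ((K+1) C(K-1,#T))`. -/
theorem rbLt_class_value_of_not_mem (h : Fin m → Fin K) {n t : ℕ} (htK : t + 1 ≤ K)
    {T : Finset (Fin m)} (hinj : Set.InjOn h ↑T) (hT : T.card ≤ t) {i : Fin K} (hi : i ∉ T.image h) :
    (if Set.InjOn h ↑(T.filter fun v => h v ≠ i) then (n : ℝ) ^ (K - (T.filter fun v => h v ≠ i).card) else 0) /
          (n.choose (T.filter fun v => h v = i).card : ℝ) *
        ∑ j ∈ range (t + 1), (-1 : ℝ) ^ j * ((t : ℝ) + 2) * (t.choose j : ℝ) *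
          ((K - 1 - ((T.filter fun v => h v ≠ i).image h).card).choose j : ℝ) *
          ((j + 2).choose (T.filter fun v => h v = i).card : ℝ) /
            (((K : ℝ) + 1) * ((K - 1).choose j : ℝ) * (((j : ℝ) + 1) * ((j : ℝ) + 2))) =
      (n : ℝ) ^ (K - T.card) * (((t : ℝ) + 2) / (((K : ℝ) + 1) * ((K - 1).choose T.card : ℝ)) *
        ((K.choose T.card : ℝ) / ((t : ℝ) + 1) - ((K + 1).choose T.card : ℝ) / (((t : ℝ) + 1) * ((t : ℝ) + 2)))) := by
  classical
  -- no vertex of `T` has colour `i`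
  have hTi : (T.filter fun v => h v = i) = ∅ := by
    rw [Finset.filter_eq_empty_iff]
    intro v hv hvi
    exact hi (mem_image.2 ⟨v, hv, hvi⟩)
  have hT' : (T.filter fun v => h v ≠ i) = T := by
    rw [Finset.filter_eq_self]
    intro v hv hvi
    exact hi (mem_image.2 ⟨v, hv, hvi⟩)
  have hH : (T.image h).card = T.card := card_image_of_injOn hinj
  rw [hTi, hT', if_pos hinj, hH, card_empty]
  simp only [Nat.choose_zero_right, Nat.cast_one, div_one, mul_one]
  set s := T.card with hs
  have hsK : s ≤ K - 1 := by omega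
  have hCKs : ((K - 1).choose s : ℝ) ≠ 0 := by
    have := Nat.choose_pos hsK
    positivity
  have hterm : ∀ j ∈ range (t + 1),
      (-1 : ℝ) ^ j * ((t : ℝ) + 2) * (t.choose j : ℝ) * ((K - 1 - s).choose j : ℝ) /
          (((K : ℝ) + 1) * ((K - 1).choose j : ℝ) * (((j : ℝ) + 1) * ((j : ℝ) + 2))) =
        (((t : ℝ) + 2) / (((K : ℝ) + 1) * ((K - 1).choose s : ℝ))) *
          ((-1 : ℝ) ^ j * (t.choose j : ℝ) * ((K - 1 - j).choose s : ℝ) / (((j : ℝ) + 1) * ((j : ℝ) + 2))) := by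
    intro j hj
    have hjt : j < t + 1 := mem_range.1 hj
    have hCKj : ((K - 1).choose j : ℝ) ≠ 0 := by
      have := Nat.choose_pos (show j ≤ K - 1 by omega)
      positivity
    have hj1 : (j : ℝ) + 1 ≠ 0 := by positivity
    have hj2 : (j : ℝ) + 2 ≠ 0 := by positivity
    have hK1 : (K : ℝ) + 1 ≠ 0 := by positivity
    have hex := choose_mul_choose_sub_comm (K - 1) s j
    have hex' : ((K - 1 - s).choose j : ℝ) =
        ((K - 1).choose j : ℝ) * ((K - 1 - j).choose s : ℝ) / ((K - 1).choose s : ℝ) := by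
      rw [eq_div_iff hCKs]; linarith
    rw [hex']
    field_simp
  rw [Finset.sum_congr rfl hterm, ← Finset.mul_sum,
    alt_sum_choose_choose_sub_div_succ_succ t s (K - 1) (by omega) (by omega),
    show K - 1 + 1 = K by omega, show K - 1 + 2 = K + 1 by omega]

/-- The per-class value is ZERO at every class when `T` is NOT rainbow (`#T ≤ t`). -/
theorem rbLt_class_value_of_not_injOn (h : Fin m → Fin K) {n t : ℕ} (htK : t + 1 ≤ K) {T : Finset (Fin m)}
    (hninj : ¬ Set.InjOn h ↑T) (hT : T.card ≤ t) (i : Fin K) :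
    (if Set.InjOn h ↑(T.filter fun v => h v ≠ i) then (n : ℝ) ^ (K - (T.filter fun v => h v ≠ i).card) else 0) /
          (n.choose (T.filter fun v => h v = i).card : ℝ) *
        ∑ j ∈ range (t + 1), (-1 : ℝ) ^ j * ((t : ℝ) + 2) * (t.choose j : ℝ) *
          ((K - 1 - ((T.filter fun v => h v ≠ i).image h).card).choose j : ℝ) *
          ((j + 2).choose (T.filter fun v => h v = i).card : ℝ) /
            (((K : ℝ) + 1) * ((K - 1).choose j : ℝ) * (((j : ℝ) + 1) * ((j : ℝ) + 2))) = 0 := by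
  classical
  set T' := T.filter fun v => h v ≠ i with hT'
  set Ti := T.filter fun v => h v = i with hTi
  set H := T'.image h with hHdef
  by_cases hinj' : Set.InjOn h ↑T'
  · -- the collision is inside class `i`: `κ = r + 2`
    have hcoll : ∃ a ∈ T, ∃ b ∈ T, h a = h b ∧ a ≠ b := by
      by_contra hno
      push Not at hno
      exact hninj fun a ha b hb hab => hno a (mem_coe.1 ha) b (mem_coe.1 hb) hab
    obtain ⟨a, ha, b, hb, hab, hne⟩ := hcoll
    have hai : h a = i := by
      by_contra hai
      have hbi : h b ≠ i := fun hbi => hai (hab.trans hbi)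
      exact hne (hinj' (mem_coe.2 (mem_filter.2 ⟨ha, hai⟩)) (mem_coe.2 (mem_filter.2 ⟨hb, hbi⟩)) hab)
    have hbi : h b = i := hab ▸ hai
    have hκ2 : 2 ≤ Ti.card := by
      have : 1 < Ti.card := Finset.one_lt_card.2 ⟨a, mem_filter.2 ⟨ha, hai⟩, b, mem_filter.2 ⟨hb, hbi⟩, hne⟩
      omega
    have hsplit : Ti.card + T'.card = T.card := by
      have := Finset.card_filter_add_card_filter_not (s := T) (fun v => h v = i)
      rw [← hTi] at this
      convert this using 2
    have hHle : H.card ≤ T'.card := card_image_le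
    obtain ⟨r, hr⟩ : ∃ r, Ti.card = r + 2 := ⟨Ti.card - 2, by omega⟩
    rw [hr]
    have hsum : ∑ j ∈ range (t + 1), (-1 : ℝ) ^ j * ((t : ℝ) + 2) * (t.choose j : ℝ) *
        ((K - 1 - H.card).choose j : ℝ) * ((j + 2).choose (r + 2) : ℝ) /
          (((K : ℝ) + 1) * ((K - 1).choose j : ℝ) * (((j : ℝ) + 1) * ((j : ℝ) + 2))) = 0 := by
      have hCKH : ((K - 1).choose H.card : ℝ) ≠ 0 := by
        have := Nat.choose_pos (show H.card ≤ K - 1 by omega)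
        positivity
      have hterm : ∀ j ∈ range (t + 1), (-1 : ℝ) ^ j * ((t : ℝ) + 2) * (t.choose j : ℝ) *
          ((K - 1 - H.card).choose j : ℝ) * ((j + 2).choose (r + 2) : ℝ) /
            (((K : ℝ) + 1) * ((K - 1).choose j : ℝ) * (((j : ℝ) + 1) * ((j : ℝ) + 2))) =
          (((t : ℝ) + 2) / (((K : ℝ) + 1) * ((K - 1).choose H.card : ℝ) * (((r : ℝ) + 1) * ((r : ℝ) + 2)))) *
            ((-1 : ℝ) ^ j * (t.choose j : ℝ) * (j.choose r : ℝ) * ((K - 1 - j).choose H.card : ℝ)) := by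
        intro j hj
        have hjt : j < t + 1 := mem_range.1 hj
        have hCKj : ((K - 1).choose j : ℝ) ≠ 0 := by
          have := Nat.choose_pos (show j ≤ K - 1 by omega)
          positivity
        have hj1 : (j : ℝ) + 1 ≠ 0 := by positivity
        have hj2 : (j : ℝ) + 2 ≠ 0 := by positivity
        have hr1 : (r : ℝ) + 1 ≠ 0 := by positivity
        have hr2 : (r : ℝ) + 2 ≠ 0 := by positivity
        have hK1 : (K : ℝ) + 1 ≠ 0 := by positivity
        have hex := choose_mul_choose_sub_comm (K - 1) H.card j
        have hex' : ((K - 1 - H.card).choose j : ℝ) =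
            ((K - 1).choose j : ℝ) * ((K - 1 - j).choose H.card : ℝ) / ((K - 1).choose H.card : ℝ) := by
          rw [eq_div_iff hCKH]; linarith
        have h22 := choose_add_two_div j r
        rw [div_eq_div_iff (by positivity) (by positivity)] at h22
        have h22' : (((j + 2).choose (r + 2) : ℕ) : ℝ) =
            ((j.choose r : ℕ) : ℝ) * (((j : ℝ) + 1) * ((j : ℝ) + 2)) / (((r : ℝ) + 1) * ((r : ℝ) + 2)) := by
          rw [eq_div_iff (by positivity)]; linarith
        rw [hex', h22']
        field_simp
      rw [Finset.sum_congr rfl hterm, ← Finset.mul_sum,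
        alt_sum_choose_mul_choose_choose_sub t r H.card (K - 1) (by omega) (by omega), mul_zero]
    rw [hsum, mul_zero]
  · rw [if_neg hinj']
    simp

/-- **Inclusion numbers of the level-`t` rainbow pseudo-distribution.** For a colouring with `K` classes of common size
`n ≥ t + 2`, `t + 1 ≤ K`, and a set `T` of at most `t` vertices:
`L_t(𝟙[T ⊆ ·]) = [T rainbow] · K · n^{K - #T} / (K + 1 - #T)` — the same as for `rbL`. [new] -/
theorem rbLt_indicator (h : Fin m → Fin K) {n t : ℕ} (hn : ∀ c, (cls h c).card = n) (htn : t + 2 ≤ n)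
    (htK : t + 1 ≤ K) (T : Finset (Fin m)) (hT : T.card ≤ t) :
    rbLt h n t (fun Q => if T ⊆ Q then 1 else 0) =
      if Set.InjOn h ↑T then (K : ℝ) * (n : ℝ) ^ (K - T.card) / ((K : ℝ) + 1 - T.card) else 0 := by
  classical
  unfold rbLt
  rw [Finset.sum_congr rfl fun i _ => rbLt_class_sum h hn htn htK T i]
  split_ifs with hinj
  · -- `s` classes carry a vertex of `T`, `K - s` do not
    set s := T.card with hs
    have hH : (T.image h).card = s := card_image_of_injOn hinj
    set X₁ : ℝ := (n : ℝ) ^ (K - s) * (((t : ℝ) + 2) * (K.choose (s - 1) : ℝ) /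
        (((K : ℝ) + 1) * ((K - 1).choose (s - 1) : ℝ) * ((t : ℝ) + 1))) with hX₁
    set X₀ : ℝ := (n : ℝ) ^ (K - s) * (((t : ℝ) + 2) / (((K : ℝ) + 1) * ((K - 1).choose s : ℝ)) *
        ((K.choose s : ℝ) / ((t : ℝ) + 1) - ((K + 1).choose s : ℝ) / (((t : ℝ) + 1) * ((t : ℝ) + 2)))) with hX₀
    have hval : ∀ i : Fin K,
        (if Set.InjOn h ↑(T.filter fun v => h v ≠ i) then (n : ℝ) ^ (K - (T.filter fun v => h v ≠ i).card) else 0) /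
              (n.choose (T.filter fun v => h v = i).card : ℝ) *
            ∑ j ∈ range (t + 1), (-1 : ℝ) ^ j * ((t : ℝ) + 2) * (t.choose j : ℝ) *
              ((K - 1 - ((T.filter fun v => h v ≠ i).image h).card).choose j : ℝ) *
              ((j + 2).choose (T.filter fun v => h v = i).card : ℝ) /
                (((K : ℝ) + 1) * ((K - 1).choose j : ℝ) * (((j : ℝ) + 1) * ((j : ℝ) + 2))) =
          if i ∈ T.image h then X₁ else X₀ := by
      intro i
      by_cases hi : i ∈ T.image h
      · rw [if_pos hi]; exact rbLt_class_value_of_mem h htn htK hinj hT hi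
      · rw [if_neg hi]; exact rbLt_class_value_of_not_mem h htK hinj hT hi
    rw [Finset.sum_congr rfl fun i _ => hval i, Finset.sum_ite, Finset.sum_const, Finset.sum_const, nsmul_eq_mul,
      nsmul_eq_mul]
    have hc1 : ((univ : Finset (Fin K)).filter fun i => i ∈ T.image h) = T.image h := by
      ext i; simp
    have hc0 : (((univ : Finset (Fin K)).filter fun i => ¬ i ∈ T.image h).card : ℝ) = (K : ℝ) - s := by
      have : ((univ : Finset (Fin K)).filter fun i => ¬ i ∈ T.image h) = univ \ T.image h := by
        ext i; simp
      rw [this, card_sdiff_of_subset (subset_univ _), card_univ, Fintype.card_fin, hH, Nat.cast_sub (by omega)]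
    rw [hc1, hH, hc0, hX₁, hX₀]
    have hsK : s ≤ K - 1 := by omega
    have hCKs : ((K - 1).choose s : ℝ) ≠ 0 := by
      have := Nat.choose_pos hsK; positivity
    have ht1 : (t : ℝ) + 1 ≠ 0 := by positivity
    have ht2 : (t : ℝ) + 2 ≠ 0 := by positivity
    have hK1' : (K : ℝ) + 1 ≠ 0 := by positivity
    have hKs : (K : ℝ) - s ≠ 0 := by
      have : (s : ℝ) + 1 ≤ K := by exact_mod_cast (show s + 1 ≤ K by omega)
      intro h0; linarith
    have hKs1 : (K : ℝ) + 1 - s ≠ 0 := by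
      have : (s : ℝ) + 1 ≤ K := by exact_mod_cast (show s + 1 ≤ K by omega)
      intro h0; linarith
    -- binomial ratios `C(K,s) (K-s) = K C(K-1,s)`, `C(K+1,s) (K+1-s) = (K+1) C(K,s)`
    have hr2 : (K.choose s : ℝ) * ((K : ℝ) - s) = (K : ℝ) * ((K - 1).choose s : ℝ) := by
      have := Nat.choose_mul_succ_eq (K - 1) s
      rw [show K - 1 + 1 = K by omega] at this
      have h' : (((K - 1).choose s : ℕ) : ℝ) * (K : ℝ) = ((K.choose s : ℕ) : ℝ) * ((K - s : ℕ) : ℝ) := by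
        exact_mod_cast this
      rw [Nat.cast_sub (by omega)] at h'
      linarith
    have hr3 : ((K + 1).choose s : ℝ) * ((K : ℝ) + 1 - s) = ((K : ℝ) + 1) * (K.choose s : ℝ) := by
      have := Nat.choose_mul_succ_eq K s
      have h' : ((K.choose s : ℕ) : ℝ) * ((K + 1 : ℕ) : ℝ) = (((K + 1).choose s : ℕ) : ℝ) * ((K + 1 - s : ℕ) : ℝ) := by
        exact_mod_cast this
      rw [Nat.cast_sub (by omega)] at h'
      push_cast at h'
      linarith
    have e2 : (K.choose s : ℝ) = (K : ℝ) * ((K - 1).choose s : ℝ) / ((K : ℝ) - s) := by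
      rw [eq_div_iff hKs]; exact hr2
    have e3 : ((K + 1).choose s : ℝ) = ((K : ℝ) + 1) * (K.choose s : ℝ) / ((K : ℝ) + 1 - s) := by
      rw [eq_div_iff hKs1]; exact hr3
    rcases Nat.eq_zero_or_pos s with hs0 | hs0
    · -- `T = ∅`: only free classes
      rw [hs0] at e2 e3 ⊢
      rw [e3, e2]
      simp only [Nat.cast_zero, sub_zero, Nat.sub_zero, zero_mul, zero_add]
      field_simp
      ring
    · have hCKs1 : ((K - 1).choose (s - 1) : ℝ) ≠ 0 := by
        have := Nat.choose_pos (show s - 1 ≤ K - 1 by omega); positivity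
      have hKs1' : (K : ℝ) - s + 1 ≠ 0 := by
        have : (s : ℝ) + 1 ≤ K := by exact_mod_cast (show s + 1 ≤ K by omega)
        intro h0; linarith
      have hr1 : (K.choose (s - 1) : ℝ) * ((K : ℝ) - s + 1) = (K : ℝ) * ((K - 1).choose (s - 1) : ℝ) := by
        have := Nat.choose_mul_succ_eq (K - 1) (s - 1)
        rw [show K - 1 + 1 = K by omega] at this
        have h' : (((K - 1).choose (s - 1) : ℕ) : ℝ) * (K : ℝ) =
            ((K.choose (s - 1) : ℕ) : ℝ) * ((K - (s - 1) : ℕ) : ℝ) := by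
          exact_mod_cast this
        rw [Nat.cast_sub (by omega), Nat.cast_sub (by omega)] at h'
        push_cast at h'
        linarith
      have e1 : (K.choose (s - 1) : ℝ) = (K : ℝ) * ((K - 1).choose (s - 1) : ℝ) / ((K : ℝ) - s + 1) := by
        rw [eq_div_iff hKs1']; exact hr1
      rw [e3, e2, e1]
      field_simp
      ring
  · exact Finset.sum_eq_zero fun i _ => rbLt_class_value_of_not_injOn h htK hinj hT i

/-- **Registered helper stub (inclusion numbers of the level-`t` rainbow pseudo-distribution).** Restatement of
`rbLt_indicator` with all parameters explicit. -/
theorem rainbow_marginal_level : ∀ {m K n t : ℕ} (h : Fin m → Fin K), (∀ c, (cls h c).card = n) → t + 2 ≤ n → t + 1 ≤ K → ∀ (T : Finset (Fin m)), T.card ≤ t → rbLt h n t (fun Q => if T ⊆ Q then 1 else 0) = if Set.InjOn h ↑T then (K : ℝ) * (n : ℝ) ^ (K - T.card) / ((K : ℝ) + 1 - T.card) else 0 := by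
  intro m K n t h hn htn htK T hT
  exact rbLt_indicator h hn htn htK T hT

end

end Summit.PneNP.PneNP.Theorems
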